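import Summits.ResolutionOfSingularities.ResolutionOfSingularities.Theorems.MarkedTransferCampaignW11PnegaGrK11
import Literature.AlgebraicGeometry.Resolution.MvPolynomialHasseOrder
import Mathlib.RingTheory.MvPolynomial.Ideal
import HarnessLib

/-!
# [OURS · L1 W1.1] «Exact-order / exact-degree» re-keys of Def 5.1 also collapse at the R04 witness
# (evidence for the W1.1′ re-key decision; seat res-L1-s11-pv-1)

LADDER-RESOLUTION rung L (rescue), cell `res-hironaka`, RESCUE-SEED slot **W1.1** (L-G1 ℘nega, «GRADED READING»),
RETIRED-DEAD by director-resolution 2026-08-26T19:49:45Z after kill test K1.1 (res-L1-k11, p465149,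
`MarkedTransferCampaignW11PnegaGrK11.lean`: the literal associated-graded reading `Campaign.pnegaGrLit` is `⊥` in every
negative degree at the R04 witness). The ruling leaves ONE door: the row lead res-adj-1 may file a RE-KEYED object W1.1′
(«a graded/filtered object provably non-zero in some negative degree at the R04 witness, stated over typed decls») by
2026-08-27T19:30Z (HOME/L/HOLD-s11.md). This file is EVIDENCE for that decision, filed `--supports
stmt-ResolutionOfSingularities-15522 --as helper` (host of the G1 OURS files; proofs only, no new objects).

WHAT IS PROVED (kernel facts about OUR typed objects; ring level `𝔽₂[y₁,x,w₁] = MvPolynomial (Fin 3) (ZMod 2)`,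
`X 0 = y₁`, `X 1 = x`, `X 2 = w₁`, `g′ = y₁² + x·w₁²`, `m = 2`, exactly the letters of the landed K1.1 file). The two
collapse theorems on record — `Campaign.K11.gr_neg_eq_bot_of_units` (p465149) and res-adj-1's `R01_collapse`
(HOME/ledger/evidence/R01/res-adj-1-G1Collapse.lean) — feed the summand `D(m,a,d) = Diff^{(dm+a)} ℘posi(E,dm)` of
Eq. (36) an operator of order `≤ dm` (admitted only because `Diff^{(dm)} ⊆ Diff^{(dm+a)}`) acting on `g^d` (of order
`dm`). The nearest conceivable re-keys therefore SHARPEN THE BOOKKEEPING: (♯) admit only operators of order EXACTLY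
`dm+a` acting on elements of `℘(E,dm)` of `𝔪`-adic order EXACTLY `dm+a`; (♭) admit only operators of order EXACTLY
`dm+a` acting on the (37)-generator power `g^d` itself. Both still produce the unit `1` in EVERY degree `−a ≤ 0`
(`a ≥ 1` for (♭)) at the witness:

* (♯) `exactSharp_unit`: `φ = y₁^a·g′^{2^k} ∈ ℘(E′,2^{k+1})` (an ideal containing `g′^{2^k}`, (П1)+(П2)), `ord_𝔪 φ =
  2^{k+1}+a` exactly (`yPow_mul_g_pow_mem_pow`, `yPow_mul_g_pow_not_mem_pow_succ`), `∂ = ∂_{y₁}^{(2^{k+1}+a)}` of order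
  exactly `2^{k+1}+a` (`Resolution.not_isDiffOpLE_hasseDeriv_single_of_lt`, res-type-073 p465511), and `∂φ = 1`
  (`hasseDeriv_yPow_mul_g_pow`);
* (♭) `exactFlat_unit`: `∂ = ∂_{y₁}^{(2^{k+1}+a)} + ∂_{y₁}^{(2^{k+1})}` has order exactly `2^{k+1}+a` for `a ≥ 1` and
  `∂(g′^{2^k}) = 0 + 1 = 1`;
* `rekey_eq_top_of_admits_sharp`, `rekey_gr_eq_bot_of_admits_sharp` (and the `flat` versions): ANY candidate family
  `Q : ℕ → Ideal 𝔽₂[y₁,x,w₁]` («the module in degree `−a`») that admits the (♯)-data (resp. the (♭)-data) for the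
  typed `℘(E′,·)` is `⊤` in every degree `a ≥ 0` (resp. `a ≥ 1`), hence its associated graded
  `Q a / Q (a−1)` is `0` for every `a ≥ 1` (resp. `a ≥ 2`) — the K1.1 outcome again.

CONSEQUENCE FOR W1.1′ (stated here as bookkeeping, not as a verdict): a re-key that is non-zero in some negative degree
at the R04 witness must leave the class «differential operators of order `dm+a` (bounded or exact) applied to an IDEAL
of `O` containing `g^d`, or to `g^d` itself» — i.e. shrink the ARGUMENT below an ideal (slot W1.2's `ρ^e`-sandwich,
`Campaign.sandwich*`, p461383) or drop `℘nega` (slot W1.3's bypass) — rather than sharpen order/degree bookkeeping.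

HONEST FRAMING. Nothing here is a statement of H. Hironaka's manuscript *Resolution of singularities in positive
characteristics* (2017-03-23, [Hironaka2017], lit key `paper:url-3343fd9e678b`); Def 5.1 / Eq. (36) (p.25 l.31–44)
and (37) (p.26 l.24–28) are CANDIDATES [claim: Hironaka2017, status: under-review] consumed only through the typed
carrier (row 008) and the hypotheses (П1) `g′ ∈ P 2`, (П2) `P i * P j ≤ P (i+j)` on an abstract family `P`. No verdict
on GAP-LEDGER rows R01/R04/R08 is implied. AI computation is weaker than expert review; nothing here is progress on
resolution of singularities in positive characteristic. All `[folklore]`; sorry-free.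
-/

noncomputable section

open MvPolynomial
open Literature.AlgebraicGeometry.Resolution
open Literature.AlgebraicGeometry.Hironaka2017.S05NegativePart

set_option linter.dupNamespace false -- mandated namespace of this single-conjunct summit

namespace Summit.ResolutionOfSingularities.ResolutionOfSingularities.Theorems.Campaign.W11ExactOrder

open Summit.ResolutionOfSingularities.ResolutionOfSingularities.Theorems.Campaign.K11

universe u v

/-! ## 0. One coefficient lemma (any ring, any variables) -/

section General

variable (K : Type u) [CommRing K] {σ : Type v} [DecidableEq σ]

/-- `D^{(k e_i)}` kills a monomial whose `x_i`-exponent is `< k`. [folklore] -/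
theorem hasseDeriv_single_monomial_eq_zero_of_lt (i : σ) {k : ℕ} (α : σ →₀ ℕ) (c : K) (h : α i < k) :
    hasseDeriv K (Finsupp.single i k) (monomial α c) = 0 := by
  ext γ
  rw [coeff_hasseDeriv_single, coeff_monomial, coeff_zero]
  by_cases hγ : α = γ + Finsupp.single i k
  · exfalso
    have := congrArg (fun β : σ →₀ ℕ => β i) hγ
    simp only [Finsupp.coe_add, Pi.add_apply, Finsupp.single_eq_same] at this
    omega
  · rw [if_neg hγ, mul_zero]

end General

/-! ## 1. The (♯) data at the witness: `φ = y₁^a · g′^{2^k}`, `∂ = ∂_{y₁}^{(2^{k+1}+a)}` -/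

section Witness

/-- `y₁^a · g′^{2^k} = y₁^{2^{k+1}+a} + y₁^a · x^{2^k} · w₁^{2^{k+1}}` (Frobenius, characteristic `2`). [folklore] -/
theorem yPow_mul_g_pow (a k : ℕ) :
    (X 0 ^ a * (X 0 ^ 2 + X 1 * X 2 ^ 2) ^ 2 ^ k : MvPolynomial (Fin 3) (ZMod 2)) =
      X 0 ^ (2 ^ (k + 1) + a) + X 0 ^ a * X 1 ^ 2 ^ k * X 2 ^ 2 ^ (k + 1) := by
  rw [g_pow_two_pow]; ring

/-- The tail `y₁^a x^{2^k} w₁^{2^{k+1}}` as a monomial. [folklore] -/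
theorem tail_eq_monomial (a k : ℕ) :
    (X 0 ^ a * X 1 ^ 2 ^ k * X 2 ^ 2 ^ (k + 1) : MvPolynomial (Fin 3) (ZMod 2)) =
      monomial (Finsupp.single 0 a + Finsupp.single 1 (2 ^ k) + Finsupp.single 2 (2 ^ (k + 1))) 1 := by
  rw [X_pow_eq_monomial, X_pow_eq_monomial, X_pow_eq_monomial, monomial_mul, monomial_mul, mul_one, mul_one]

/-- **(♯) the unit**: `∂_{y₁}^{(2^{k+1}+a)}(y₁^a · g′^{2^k}) = 1` — the tail has `y₁`-degree `a < 2^{k+1}+a`. [folklore] -/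
theorem hasseDeriv_yPow_mul_g_pow (a k : ℕ) :
    hasseDeriv (ZMod 2) (Finsupp.single (0 : Fin 3) (2 ^ (k + 1) + a))
      (X 0 ^ a * (X 0 ^ 2 + X 1 * X 2 ^ 2) ^ 2 ^ k : MvPolynomial (Fin 3) (ZMod 2)) = 1 := by
  have hzero : hasseDeriv (ZMod 2) (Finsupp.single (0 : Fin 3) (2 ^ (k + 1) + a))
      (X 0 ^ a * X 1 ^ 2 ^ k * X 2 ^ 2 ^ (k + 1) : MvPolynomial (Fin 3) (ZMod 2)) = 0 := by
    rw [tail_eq_monomial]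
    refine hasseDeriv_single_monomial_eq_zero_of_lt (ZMod 2) 0 _ 1 ?_
    simp only [Finsupp.coe_add, Pi.add_apply, Finsupp.single_eq_same,
      Finsupp.single_eq_of_ne (show (0 : Fin 3) ≠ 1 by decide),
      Finsupp.single_eq_of_ne (show (0 : Fin 3) ≠ 2 by decide), add_zero]
    have : 0 < 2 ^ (k + 1) := Nat.two_pow_pos _
    omega
  rw [yPow_mul_g_pow, map_add, hzero, add_zero, hasseDeriv_single_X_pow_self]

/-- `φ = y₁^a · g′^{2^k}` lies in `𝔪^{2^{k+1}+a}` (`𝔪 = (y₁, x, w₁)`). [folklore] -/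
theorem yPow_mul_g_pow_mem_pow (a k : ℕ) :
    (X 0 ^ a * (X 0 ^ 2 + X 1 * X 2 ^ 2) ^ 2 ^ k : MvPolynomial (Fin 3) (ZMod 2)) ∈
      idealOfVars (Fin 3) (ZMod 2) ^ (2 ^ (k + 1) + a) := by
  rw [mem_pow_idealOfVars_iff']
  intro x hx
  rw [yPow_mul_g_pow, coeff_add, tail_eq_monomial, coeff_monomial, X_pow_eq_monomial, coeff_monomial]
  have h1 : ¬ Finsupp.single (0 : Fin 3) (2 ^ (k + 1) + a) = x := by
    rintro rfl
    rw [Finsupp.degree_single] at hx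
    exact lt_irrefl _ hx
  have h2 : ¬ (Finsupp.single (0 : Fin 3) a + Finsupp.single 1 (2 ^ k) + Finsupp.single 2 (2 ^ (k + 1))) = x := by
    rintro rfl
    simp only [map_add, Finsupp.degree_single] at hx
    have : 0 < 2 ^ k := Nat.two_pow_pos _
    omega
  rw [if_neg h1, if_neg h2, add_zero]

/-- `φ = y₁^a · g′^{2^k}` does NOT lie in `𝔪^{2^{k+1}+a+1}`: its `𝔪`-adic order is exactly `2^{k+1}+a = dm + a`
(`d = 2^k`, `m = 2`). [folklore] -/
theorem yPow_mul_g_pow_not_mem_pow_succ (a k : ℕ) :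
    (X 0 ^ a * (X 0 ^ 2 + X 1 * X 2 ^ 2) ^ 2 ^ k : MvPolynomial (Fin 3) (ZMod 2)) ∉
      idealOfVars (Fin 3) (ZMod 2) ^ (2 ^ (k + 1) + a + 1) := by
  rw [mem_pow_idealOfVars_iff']
  intro h
  have hx := h (Finsupp.single (0 : Fin 3) (2 ^ (k + 1) + a)) (by rw [Finsupp.degree_single]; omega)
  rw [yPow_mul_g_pow, coeff_add, tail_eq_monomial, coeff_monomial, X_pow_eq_monomial, coeff_monomial, if_pos rfl,
    if_neg, add_zero] at hx
  · exact one_ne_zero hx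
  · intro heq
    have := congrArg (fun β : Fin 3 →₀ ℕ => β 1) heq
    simp only [Finsupp.coe_add, Pi.add_apply, Finsupp.single_eq_same,
      Finsupp.single_eq_of_ne (show (1 : Fin 3) ≠ 0 by decide),
      Finsupp.single_eq_of_ne (show (1 : Fin 3) ≠ 2 by decide), zero_add, add_zero] at this
    exact pow_ne_zero _ two_ne_zero this

/-- `φ = y₁^a · g′^{2^k} ∈ ℘(E′, 2^{k+1})` under (П1)+(П2): `℘(E′,2^{k+1})` is an ideal containing `g′^{2^k}`.
[folklore] -/
theorem yPow_mul_g_pow_mem (P : ℕ → Ideal (MvPolynomial (Fin 3) (ZMod 2)))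
    (h1 : (X 0 ^ 2 + X 1 * X 2 ^ 2 : MvPolynomial (Fin 3) (ZMod 2)) ∈ P 2)
    (h2 : ∀ i j : ℕ, P i * P j ≤ P (i + j)) (a k : ℕ) :
    (X 0 ^ a * (X 0 ^ 2 + X 1 * X 2 ^ 2) ^ 2 ^ k : MvPolynomial (Fin 3) (ZMod 2)) ∈ P (2 ^ k * 2) := by
  rw [show 2 ^ k * 2 = 2 * 2 ^ k by ring]
  exact Ideal.mul_mem_left _ _ (g_pow_mem P h1 h2 (2 ^ k) Nat.one_le_two_pow)

/-- `∂_{y₁}^{(N)}` has order `≤ N`. [folklore] -/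
theorem isDiffOpLE_hasse_y (N : ℕ) :
    IsDiffOpLE (ZMod 2) N (hasseDeriv (ZMod 2) (Finsupp.single (0 : Fin 3) N)) :=
  isDiffOpLE_hasseDeriv (ZMod 2) N _ (by rw [Finsupp.degree_single])

/-- `∂_{y₁}^{(N)}` is NOT of order `≤ N − 1` when `N ≥ 1` (order exactly `N`). [folklore] -/
theorem not_isDiffOpLE_hasse_y_pred {N : ℕ} (hN : 1 ≤ N) :
    ¬ IsDiffOpLE (ZMod 2) (N - 1) (hasseDeriv (ZMod 2) (Finsupp.single (0 : Fin 3) N)) :=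
  not_isDiffOpLE_hasseDeriv_single_of_lt (ZMod 2) (0 : Fin 3) (by omega)

/-- **(♯) at the witness, every degree `−a ≤ 0`**: for `d = 2^k` with `2^{k+1} ≥ a` (e.g. `k = a`) the operator
`∂ = ∂_{y₁}^{(dm+a)}` has order EXACTLY `dm + a`, the element `φ = y₁^a g′^d ∈ ℘(E′,dm)` has `𝔪`-adic order EXACTLY
`dm + a`, and `∂φ = 1`. [folklore] -/
theorem exactSharp_unit (P : ℕ → Ideal (MvPolynomial (Fin 3) (ZMod 2)))
    (h1 : (X 0 ^ 2 + X 1 * X 2 ^ 2 : MvPolynomial (Fin 3) (ZMod 2)) ∈ P 2)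
    (h2 : ∀ i j : ℕ, P i * P j ≤ P (i + j)) (a k : ℕ) :
    IsDiffOpLE (ZMod 2) (2 ^ k * 2 + a) (hasseDeriv (ZMod 2) (Finsupp.single (0 : Fin 3) (2 ^ (k + 1) + a))) ∧
    ¬ IsDiffOpLE (ZMod 2) (2 ^ k * 2 + a - 1)
        (hasseDeriv (ZMod 2) (Finsupp.single (0 : Fin 3) (2 ^ (k + 1) + a))) ∧
    (X 0 ^ a * (X 0 ^ 2 + X 1 * X 2 ^ 2) ^ 2 ^ k : MvPolynomial (Fin 3) (ZMod 2)) ∈ P (2 ^ k * 2) ∧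
    (X 0 ^ a * (X 0 ^ 2 + X 1 * X 2 ^ 2) ^ 2 ^ k : MvPolynomial (Fin 3) (ZMod 2)) ∈
      idealOfVars (Fin 3) (ZMod 2) ^ (2 ^ k * 2 + a) ∧
    (X 0 ^ a * (X 0 ^ 2 + X 1 * X 2 ^ 2) ^ 2 ^ k : MvPolynomial (Fin 3) (ZMod 2)) ∉
      idealOfVars (Fin 3) (ZMod 2) ^ (2 ^ k * 2 + a + 1) ∧
    hasseDeriv (ZMod 2) (Finsupp.single (0 : Fin 3) (2 ^ (k + 1) + a))
      (X 0 ^ a * (X 0 ^ 2 + X 1 * X 2 ^ 2) ^ 2 ^ k : MvPolynomial (Fin 3) (ZMod 2)) = 1 := by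
  have hd : 2 ^ k * 2 = 2 ^ (k + 1) := (pow_succ 2 k).symm
  rw [hd]
  exact ⟨isDiffOpLE_hasse_y _, not_isDiffOpLE_hasse_y_pred (by have := Nat.two_pow_pos (k + 1); omega),
    hd ▸ yPow_mul_g_pow_mem P h1 h2 a k, yPow_mul_g_pow_mem_pow a k, yPow_mul_g_pow_not_mem_pow_succ a k,
    hasseDeriv_yPow_mul_g_pow a k⟩

/-! ## 2. The (♭) data at the witness: `∂ = ∂_{y₁}^{(2^{k+1}+a)} + ∂_{y₁}^{(2^{k+1})}` on `g′^{2^k}` itself -/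

/-- For `a ≥ 1`, `∂_{y₁}^{(2^{k+1}+a)}(g′^{2^k}) = 0` (both monomials of `g′^{2^k}` have `y₁`-degree `< 2^{k+1}+a`).
[folklore] -/
theorem hasseDeriv_high_g_pow (a k : ℕ) (ha : 1 ≤ a) :
    hasseDeriv (ZMod 2) (Finsupp.single (0 : Fin 3) (2 ^ (k + 1) + a))
      ((X 0 ^ 2 + X 1 * X 2 ^ 2) ^ 2 ^ k : MvPolynomial (Fin 3) (ZMod 2)) = 0 := by
  have h0 := hasseDeriv_yPow_mul_g_pow 0 k
  have htail : (X 1 ^ 2 ^ k * X 2 ^ 2 ^ (k + 1) : MvPolynomial (Fin 3) (ZMod 2)) =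
      monomial (Finsupp.single 1 (2 ^ k) + Finsupp.single 2 (2 ^ (k + 1))) 1 := by
    rw [X_pow_eq_monomial, X_pow_eq_monomial, monomial_mul, mul_one]
  rw [g_pow_two_pow, map_add, X_pow_eq_monomial, htail,
    hasseDeriv_single_monomial_eq_zero_of_lt (ZMod 2) 0 _ 1 (by rw [Finsupp.single_eq_same]; omega),
    hasseDeriv_single_monomial_eq_zero_of_lt (ZMod 2) 0 _ 1 (by
      simp only [Finsupp.coe_add, Pi.add_apply, Finsupp.single_eq_of_ne (show (0 : Fin 3) ≠ 1 by decide),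
        Finsupp.single_eq_of_ne (show (0 : Fin 3) ≠ 2 by decide), add_zero]
      have := Nat.two_pow_pos (k + 1); omega),
    add_zero]

/-- **(♭) at the witness, every degree `−a < 0`**: the operator `∂ = ∂_{y₁}^{(dm+a)} + ∂_{y₁}^{(dm)}` (`d = 2^k`,
`m = 2`, `a ≥ 1`) has order EXACTLY `dm + a` and takes the (37)-power `g′^d ∈ ℘(E′,dm)` (of order exactly `dm`) to
`0 + 1 = 1`. [folklore] -/
theorem exactFlat_unit (P : ℕ → Ideal (MvPolynomial (Fin 3) (ZMod 2)))
    (h1 : (X 0 ^ 2 + X 1 * X 2 ^ 2 : MvPolynomial (Fin 3) (ZMod 2)) ∈ P 2)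
    (h2 : ∀ i j : ℕ, P i * P j ≤ P (i + j)) (a k : ℕ) (ha : 1 ≤ a) :
    IsDiffOpLE (ZMod 2) (2 ^ k * 2 + a)
        (hasseDeriv (ZMod 2) (Finsupp.single (0 : Fin 3) (2 ^ (k + 1) + a)) +
          hasseDeriv (ZMod 2) (Finsupp.single (0 : Fin 3) (2 ^ (k + 1)))) ∧
    ¬ IsDiffOpLE (ZMod 2) (2 ^ k * 2 + a - 1)
        (hasseDeriv (ZMod 2) (Finsupp.single (0 : Fin 3) (2 ^ (k + 1) + a)) +
          hasseDeriv (ZMod 2) (Finsupp.single (0 : Fin 3) (2 ^ (k + 1)))) ∧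
    ((X 0 ^ 2 + X 1 * X 2 ^ 2) ^ 2 ^ k : MvPolynomial (Fin 3) (ZMod 2)) ∈ P (2 ^ k * 2) ∧
    (hasseDeriv (ZMod 2) (Finsupp.single (0 : Fin 3) (2 ^ (k + 1) + a)) +
          hasseDeriv (ZMod 2) (Finsupp.single (0 : Fin 3) (2 ^ (k + 1))))
      ((X 0 ^ 2 + X 1 * X 2 ^ 2) ^ 2 ^ k : MvPolynomial (Fin 3) (ZMod 2)) = 1 := by
  have hd : 2 ^ k * 2 = 2 ^ (k + 1) := (pow_succ 2 k).symm
  rw [hd]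
  refine ⟨(isDiffOpLE_hasse_y _).add ((isDiffOpLE_hasse_y _).of_le (by omega)), fun h => ?_, ?_, ?_⟩
  · have hlow : IsDiffOpLE (ZMod 2) (2 ^ (k + 1) + a - 1)
        (hasseDeriv (ZMod 2) (Finsupp.single (0 : Fin 3) (2 ^ (k + 1)))) :=
      (isDiffOpLE_hasse_y _).of_le (by omega)
    have := h.sub hlow
    rw [add_sub_cancel_right] at this
    exact not_isDiffOpLE_hasse_y_pred (by omega) this
  · rw [show 2 ^ (k + 1) = 2 * 2 ^ k by ring]
    exact g_pow_mem P h1 h2 (2 ^ k) Nat.one_le_two_pow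
  · rw [LinearMap.add_apply, hasseDeriv_high_g_pow a k ha, zero_add, hasseDeriv_g_pow]

/-! ## 3. Consequence: every re-key admitting the (♯)- or (♭)-data is `⊤` in all degrees `≤ 0`, its graded part `0` -/

/-- **No-go (♯).** Let `Q a` be ANY candidate «module of `E′` in degree `−a`» (an ideal of `O_{ξ′}`) that admits the
exact-order/exact-degree data: whenever `a ≤ d·m`, `∂` has order exactly `dm+a`, `φ ∈ ℘(E′,dm)` has `𝔪`-adic order
exactly `dm+a`, then `∂φ ∈ Q a` (`m = 2`). Then `Q a = (1)` for EVERY `a ≥ 0` at the witness. [folklore] -/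
theorem rekey_eq_top_of_admits_sharp (P Q : ℕ → Ideal (MvPolynomial (Fin 3) (ZMod 2)))
    (h1 : (X 0 ^ 2 + X 1 * X 2 ^ 2 : MvPolynomial (Fin 3) (ZMod 2)) ∈ P 2)
    (h2 : ∀ i j : ℕ, P i * P j ≤ P (i + j))
    (hQ : ∀ (a d : ℕ) (D : MvPolynomial (Fin 3) (ZMod 2) →ₗ[ZMod 2] MvPolynomial (Fin 3) (ZMod 2))
      (φ : MvPolynomial (Fin 3) (ZMod 2)), a ≤ d * 2 → IsDiffOpLE (ZMod 2) (d * 2 + a) D →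
      ¬ IsDiffOpLE (ZMod 2) (d * 2 + a - 1) D → φ ∈ P (d * 2) →
      φ ∈ idealOfVars (Fin 3) (ZMod 2) ^ (d * 2 + a) → φ ∉ idealOfVars (Fin 3) (ZMod 2) ^ (d * 2 + a + 1) →
      D φ ∈ Q a) (a : ℕ) : Q a = ⊤ := by
  obtain ⟨hD, hnD, hφ, hm, hnm, hu⟩ := exactSharp_unit P h1 h2 a a
  have hle : a ≤ 2 ^ a * 2 :=
    (Nat.lt_two_pow_self).le.trans (Nat.le_mul_of_pos_right _ (by norm_num))
  have := hQ a (2 ^ a) _ _ hle hD hnD hφ hm hnm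
  rw [hu] at this
  exact (Ideal.eq_top_iff_one _).mpr this

/-- **No-go (♯), graded form.** Under the same admission hypothesis, the associated graded `Q a / Q (a−1)` (the
image of `Q a` in `O ⧸ Q (a−1)`) is `0` for every `a` (meant for `a ≥ 1`; at `a = 0` it reads `Q 0 / Q 0 = 0`) — the
K1.1 outcome («degenerate-zero») for every exact-order/exact-degree re-key. [folklore] -/
theorem rekey_gr_eq_bot_of_admits_sharp (P Q : ℕ → Ideal (MvPolynomial (Fin 3) (ZMod 2)))
    (h1 : (X 0 ^ 2 + X 1 * X 2 ^ 2 : MvPolynomial (Fin 3) (ZMod 2)) ∈ P 2)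
    (h2 : ∀ i j : ℕ, P i * P j ≤ P (i + j))
    (hQ : ∀ (a d : ℕ) (D : MvPolynomial (Fin 3) (ZMod 2) →ₗ[ZMod 2] MvPolynomial (Fin 3) (ZMod 2))
      (φ : MvPolynomial (Fin 3) (ZMod 2)), a ≤ d * 2 → IsDiffOpLE (ZMod 2) (d * 2 + a) D →
      ¬ IsDiffOpLE (ZMod 2) (d * 2 + a - 1) D → φ ∈ P (d * 2) →
      φ ∈ idealOfVars (Fin 3) (ZMod 2) ^ (d * 2 + a) → φ ∉ idealOfVars (Fin 3) (ZMod 2) ^ (d * 2 + a + 1) →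
      D φ ∈ Q a) (a : ℕ) :
    Submodule.map (Q (a - 1)).mkQ (Q a) = ⊥ := by
  rw [← LinearMap.le_ker_iff_map, Submodule.ker_mkQ, rekey_eq_top_of_admits_sharp P Q h1 h2 hQ (a - 1)]
  exact le_top

/-- **No-go (♭).** Let `Q a` admit the data «operator of order exactly `dm+a` applied to the (37)-power `g′^d ∈
℘(E′,dm)`», `a ≤ dm`. Then `Q a = (1)` for every `a ≥ 1` at the witness. [folklore] -/
theorem rekey_eq_top_of_admits_flat (P Q : ℕ → Ideal (MvPolynomial (Fin 3) (ZMod 2)))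
    (h1 : (X 0 ^ 2 + X 1 * X 2 ^ 2 : MvPolynomial (Fin 3) (ZMod 2)) ∈ P 2)
    (h2 : ∀ i j : ℕ, P i * P j ≤ P (i + j))
    (hQ : ∀ (a d : ℕ) (D : MvPolynomial (Fin 3) (ZMod 2) →ₗ[ZMod 2] MvPolynomial (Fin 3) (ZMod 2)),
      a ≤ d * 2 → IsDiffOpLE (ZMod 2) (d * 2 + a) D → ¬ IsDiffOpLE (ZMod 2) (d * 2 + a - 1) D →
      ((X 0 ^ 2 + X 1 * X 2 ^ 2) ^ d : MvPolynomial (Fin 3) (ZMod 2)) ∈ P (d * 2) →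
      D ((X 0 ^ 2 + X 1 * X 2 ^ 2) ^ d) ∈ Q a) (a : ℕ) (ha : 1 ≤ a) : Q a = ⊤ := by
  obtain ⟨hD, hnD, hφ, hu⟩ := exactFlat_unit P h1 h2 a a ha
  have hle : a ≤ 2 ^ a * 2 :=
    (Nat.lt_two_pow_self).le.trans (Nat.le_mul_of_pos_right _ (by norm_num))
  have := hQ a (2 ^ a) _ hle hD hnD hφ
  rw [hu] at this
  exact (Ideal.eq_top_iff_one _).mpr this

/-- **No-go (♭), graded form**: `Q a / Q (a−1) = 0` for every `a ≥ 2`. [folklore] -/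
theorem rekey_gr_eq_bot_of_admits_flat (P Q : ℕ → Ideal (MvPolynomial (Fin 3) (ZMod 2)))
    (h1 : (X 0 ^ 2 + X 1 * X 2 ^ 2 : MvPolynomial (Fin 3) (ZMod 2)) ∈ P 2)
    (h2 : ∀ i j : ℕ, P i * P j ≤ P (i + j))
    (hQ : ∀ (a d : ℕ) (D : MvPolynomial (Fin 3) (ZMod 2) →ₗ[ZMod 2] MvPolynomial (Fin 3) (ZMod 2)),
      a ≤ d * 2 → IsDiffOpLE (ZMod 2) (d * 2 + a) D → ¬ IsDiffOpLE (ZMod 2) (d * 2 + a - 1) D →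
      ((X 0 ^ 2 + X 1 * X 2 ^ 2) ^ d : MvPolynomial (Fin 3) (ZMod 2)) ∈ P (d * 2) →
      D ((X 0 ^ 2 + X 1 * X 2 ^ 2) ^ d) ∈ Q a) (a : ℕ) (ha : 2 ≤ a) :
    Submodule.map (Q (a - 1)).mkQ (Q a) = ⊥ := by
  rw [← LinearMap.le_ker_iff_map, Submodule.ker_mkQ, rekey_eq_top_of_admits_flat P Q h1 h2 hQ (a - 1) (by omega)]
  exact le_top

/-- **The literal reading is one instance**: the typed `℘nega(E′,−a) = pNega (ZMod 2) P 2 a` admits the (♯)-data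
(its summand `D(2,a,d) = Diff^{(2d+a)} ℘posi(E′,2d)` admits every operator of order `≤ 2d+a` on every element of
`℘(E′,2d)`), so the no-go specialises to K1.1's `pNega_witness_eq_top` — recorded to show the hypothesis `hQ` is
not vacuous. [folklore] -/
theorem pNega_admits_sharp (P : ℕ → Ideal (MvPolynomial (Fin 3) (ZMod 2))) (a d : ℕ)
    (D : MvPolynomial (Fin 3) (ZMod 2) →ₗ[ZMod 2] MvPolynomial (Fin 3) (ZMod 2))
    (φ : MvPolynomial (Fin 3) (ZMod 2)) (had : a ≤ d * 2) (hD : IsDiffOpLE (ZMod 2) (d * 2 + a) D)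
    (hφ : φ ∈ P (d * 2)) (hd : d ≠ 0) : D φ ∈ pNega (ZMod 2) P 2 a := by
  have hrange : |((a : ℕ) : ℤ)| ≤ (d : ℤ) * ((2 : ℕ) : ℤ) := by
    rw [Nat.abs_cast]; exact_mod_cast had
  unfold pNega pTildeNeg
  refine (le_iSup₂ (f := fun (d' : ℤ) (_ : |((a : ℕ) : ℤ)| ≤ d' * ((2 : ℕ) : ℤ)) => DD (ZMod 2) P 2 (a : ℤ) d')
    (d : ℤ) hrange) ?_
  show D φ ∈ DD (ZMod 2) P 2 (a : ℤ) (d : ℤ)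
  have e1 : ((d : ℤ) * ((2 : ℕ) : ℤ) + ((a : ℕ) : ℤ)).toNat = d * 2 + a := by
    rw [show ((d : ℤ) * ((2 : ℕ) : ℤ) + ((a : ℕ) : ℤ)) = ((d * 2 + a : ℕ) : ℤ) by push_cast; ring]
    exact Int.toNat_natCast _
  have e2 : ((d : ℤ) * ((2 : ℕ) : ℤ)).toNat = d * 2 := by
    rw [show ((d : ℤ) * ((2 : ℕ) : ℤ)) = ((d * 2 : ℕ) : ℤ) by push_cast; ring]
    exact Int.toNat_natCast _
  rw [DD, e1, e2, pPosi_of_ne_zero P (show d * 2 ≠ 0 by omega)]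
  exact apply_mem_diffIdeal (ZMod 2) hD hφ

end Witness

end Summit.ResolutionOfSingularities.ResolutionOfSingularities.Theorems.Campaign.W11ExactOrder

end
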